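import Mathlib
import Summits.Ventures.PercRepro2.K5Kernel
import Summits.Ventures.PercRepro2.K5Kron
import Summits.Ventures.PercRepro2.K5Digits
import Summits.Ventures.PercRepro2.K5Theorem
import Summits.Ventures.PercRepro2.PMK5Kernel
import Summits.Ventures.PercRepro2.PMK5Typed
import Summits.Ventures.PercRepro2.PMTypedTri

/-!
# The `K₅` kernel certificate of the `Y`-slacks of the pendant-at-`b` row (the `a₃ = b` coincidence value)
(blind cell PercRepro2, mine-2 g24; for Theorem 20 — the equality locus of (HCOV) on the six-vertex family
`K₅ + a₃ pendant at b`; on p1 g7's `PendantBRow.pendantB_bernstein`)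

With `a₃` a leaf at `b` (edge weight `q`), p1's Bernstein identity writes the crux functional as
`(1 − q)² · 2P (Z_L + Z_H) + 2q(1 − q) · [(2bL + D) Z_L + (2bH + D) Z_H + P (Y_L + Y_H)] + q² · 2[(2bL + D) Y_L + (2bH + D) Y_H]`
in the `a₃`-free masses under `Q = {a₁ ↮ a₂}` on `K₅` (`o = 0, a₁ = 1, a₂ = 2, u = 3, b = 4`): `P = P(Q)`, `bL = P(Q, bL)`,
`bH`, `oL`, `oH`, `A = P(Q, oL, bL)`, `B = P(Q, oH, bH)`, `C = P(Q, oH, bL)`, `Dd = P(Q, oL, bH)`, `D = P − bL − bH`,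
with the four BHK-1.4 slacks `Z_L = oL·bH − P·Dd`, `Z_H = oH·bL − P·C` (their sum is the `a₃`-inactive value `I / 2P`,
`PMK5Inactive.lean`) and `Y_L = bH (oL − A − Dd) − D·Dd`, `Y_H = bL (oH − B − C) − D·C` — all `≥ 0` (`PendantBRow.lean`).
This file certifies **`Y := Y_L + Y_H`** on `K₅`: expanded, `Y_L = bH·oL + bL·Dd − bH·A − P·Dd` and
`Y_H = bL·oH + bH·C − bL·B − P·C`, eight products of two masses; with the all-true table `tOne` as a third factor
each is a degree-3 Bernstein form (`prob_univ`), so **`certY`** (one `decide +kernel`) gives every Bernstein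
coefficient `cntPosY − cntNegY ≥ 0` (`cntNegY_le_cntPosY`) and **`y_eq_bern`** is the bridge `Y = Σ_k bern p k ·
(cntPosY k − cntNegY k)`.  Two new tables: `tQLoBL` (`Q ∧ oL ∧ bL` = `A`), `tQHoBH` (`Q ∧ oH ∧ bH` = `B`).
-/

namespace Summit.Ventures.PercRepro2

open Hub CovForm

namespace K5

namespace PM

/-! ## The tables -/

/-- The all-true table (the third factor of a product of two masses). -/
def tOne (_ : Fin 10 → Bool) : Bool := true

/-- `Q ∧ {o ∈ C₁} ∧ {b ∈ C₁}` (the mass `A`). -/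
def tQLoBL (ω : Fin 10 → Bool) : Bool := tQ ω && conn ω 1 0 && conn ω 1 4

/-- `Q ∧ {o ∈ C₂} ∧ {b ∈ C₂}` (the mass `B`). -/
def tQHoBH (ω : Fin 10 → Bool) : Bool := tQ ω && conn ω 2 0 && conn ω 2 4

/-- `tOne ω ↔ ω ∈ univ`. -/
lemma tOne_iff (ω : Fin 10 → Bool) : tOne ω = true ↔ ω ∈ (Set.univ : Set (Config (Fin 10))) := by
  simp [tOne]

/-- `tQLoBL ω ↔ ω ∈ Q ∩ ({o ∈ C₁} ∩ {b ∈ C₁})`. -/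
lemma tQLoBL_iff (ω : Fin 10 → Bool) :
    tQLoBL ω = true ↔ ω ∈ avoidAll ends5 2 {1} ∩ (connEvent ends5 1 0 ∩ connEvent ends5 1 4) := by
  unfold tQLoBL
  rw [Bool.and_eq_true, Bool.and_eq_true, tQ_iff, conn_iff_mem ω (by norm_num) (by norm_num),
    conn_iff_mem ω (by norm_num) (by norm_num)]
  simp only [Set.mem_inter_iff]; tauto

/-- `tQHoBH ω ↔ ω ∈ Q ∩ ({o ∈ C₂} ∩ {b ∈ C₂})`. -/
lemma tQHoBH_iff (ω : Fin 10 → Bool) :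
    tQHoBH ω = true ↔ ω ∈ avoidAll ends5 2 {1} ∩ (connEvent ends5 2 0 ∩ connEvent ends5 2 4) := by
  unfold tQHoBH
  rw [Bool.and_eq_true, Bool.and_eq_true, tQ_iff, conn_iff_mem ω (by norm_num) (by norm_num),
    conn_iff_mem ω (by norm_num) (by norm_num)]
  simp only [Set.mem_inter_iff]; tauto

/-! ## The Kronecker numbers and the certificate -/

/-- The positive part of `Y`: `bH·oL + bL·Dd + bL·oH + bH·C` (each times the all-true table). -/
def kPosY : ℕ :=
  kron tQB * kron tQLo * kron tOne + kron tQBL * kron tQBLo * kron tOne +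
  kron tQBL * kron tQHo * kron tOne + kron tQB * kron tQBLHo * kron tOne

/-- The negative part of `Y`: `bH·A + P·Dd + bL·B + P·C`. -/
def kNegY : ℕ :=
  kron tQB * kron tQLoBL * kron tOne + kron tQ * kron tQBLo * kron tOne +
  kron tQBL * kron tQHoBH * kron tOne + kron tQ * kron tQBLHo * kron tOne

set_option maxRecDepth 100000 in
set_option maxHeartbeats 0 in
/-- **The `K₅` certificate of the `Y`-slacks**: `kPosY ≥ kNegY` digitwise. -/
theorem certY : kNegY ≤ kPosY ∧ Nat.land (kPosY - kNegY) mask = 0 ∧ Nat.land kNegY mask = 0 := by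
  decide +kernel

/-- The positive triple counts of `Y`. -/
def cntPosY (k : Fin 10 → Fin 4) : ℕ :=
  cnt3 tQB tQLo tOne k + cnt3 tQBL tQBLo tOne k + cnt3 tQBL tQHo tOne k + cnt3 tQB tQBLHo tOne k

/-- The negative triple counts of `Y`. -/
def cntNegY (k : Fin 10 → Fin 4) : ℕ :=
  cnt3 tQB tQLoBL tOne k + cnt3 tQ tQBLo tOne k + cnt3 tQBL tQHoBH tOne k + cnt3 tQ tQBLHo tOne k

/-- `kPosY` carries the positive counts. -/
lemma kPosY_eq : kPosY = ∑ k, cntPosY k * KB ^ idx4 k :=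
  calc kPosY = kronSum tQB * kronSum tQLo * kronSum tOne + kronSum tQBL * kronSum tQBLo * kronSum tOne +
        kronSum tQBL * kronSum tQHo * kronSum tOne + kronSum tQB * kronSum tQBLHo * kronSum tOne := by
        unfold kPosY
        rw [kron_eq_kronSum tQB, kron_eq_kronSum tQLo, kron_eq_kronSum tOne, kron_eq_kronSum tQBL,
          kron_eq_kronSum tQBLo, kron_eq_kronSum tQHo, kron_eq_kronSum tQBLHo]
    _ = ∑ k, cnt3 tQB tQLo tOne k * KB ^ idx4 k + ∑ k, cnt3 tQBL tQBLo tOne k * KB ^ idx4 k +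
        ∑ k, cnt3 tQBL tQHo tOne k * KB ^ idx4 k + ∑ k, cnt3 tQB tQBLHo tOne k * KB ^ idx4 k := by
        rw [kronSum_mul_mul, kronSum_mul_mul, kronSum_mul_mul, kronSum_mul_mul]
    _ = ∑ k, cntPosY k * KB ^ idx4 k := sum_add4_mul5 _ _ _ _

/-- `kNegY` carries the negative counts. -/
lemma kNegY_eq : kNegY = ∑ k, cntNegY k * KB ^ idx4 k :=
  calc kNegY = kronSum tQB * kronSum tQLoBL * kronSum tOne + kronSum tQ * kronSum tQBLo * kronSum tOne +
        kronSum tQBL * kronSum tQHoBH * kronSum tOne + kronSum tQ * kronSum tQBLHo * kronSum tOne := by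
        unfold kNegY
        rw [kron_eq_kronSum tQB, kron_eq_kronSum tQLoBL, kron_eq_kronSum tOne, kron_eq_kronSum tQ,
          kron_eq_kronSum tQBLo, kron_eq_kronSum tQBL, kron_eq_kronSum tQHoBH, kron_eq_kronSum tQBLHo]
    _ = ∑ k, cnt3 tQB tQLoBL tOne k * KB ^ idx4 k + ∑ k, cnt3 tQ tQBLo tOne k * KB ^ idx4 k +
        ∑ k, cnt3 tQBL tQHoBH tOne k * KB ^ idx4 k + ∑ k, cnt3 tQ tQBLHo tOne k * KB ^ idx4 k := by
        rw [kronSum_mul_mul, kronSum_mul_mul, kronSum_mul_mul, kronSum_mul_mul]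
    _ = ∑ k, cntNegY k * KB ^ idx4 k := sum_add4_mul5 _ _ _ _

/-- The counts are bounded by `4 · 3^10 < 2^19`. -/
lemma cntPosY_lt (k : Fin 10 → Fin 4) : cntPosY k < 2 ^ 19 := by
  unfold cntPosY
  have := cnt3_le tQB tQLo tOne k
  have := cnt3_le tQBL tQBLo tOne k
  have := cnt3_le tQBL tQHo tOne k
  have := cnt3_le tQB tQBLHo tOne k
  omega

/-- The counts are bounded by `4 · 3^10 < 2^19`. -/
lemma cntNegY_lt (k : Fin 10 → Fin 4) : cntNegY k < 2 ^ 19 := by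
  unfold cntNegY
  have := cnt3_le tQB tQLoBL tOne k
  have := cnt3_le tQ tQBLo tOne k
  have := cnt3_le tQBL tQHoBH tOne k
  have := cnt3_le tQ tQBLHo tOne k
  omega

/-- **Every Bernstein coefficient of `Y` on `K₅` is `≥ 0`** (from `certY`). -/
theorem cntNegY_le_cntPosY (k : Fin 10 → Fin 4) : cntNegY k ≤ cntPosY k :=
  le_of_kron_le cntPosY cntNegY cntPosY_lt cntNegY_lt kPosY_eq kNegY_eq certY.1 certY.2.1 k

/-! ## `Y` in the Bernstein basis -/

section Bernstein

variable {R : Type*} [Field R] [LinearOrder R] [IsStrictOrderedRing R]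

omit [LinearOrder R] [IsStrictOrderedRing R] in
/-- `1 = bform p (indR tOne)`. -/
lemma one_eq_bform (p : Fin 10 → R) : (1 : R) = bform p (indR tOne) := by
  rw [← prob_univ p, prob_eq_bform p _ _ tOne_iff]

omit [LinearOrder R] [IsStrictOrderedRing R] in
/-- **The `Y`-slacks `Y_L + Y_H` on `K₅` in the degree-3 Bernstein basis** (the masses in the `Q ∩ ·` form of
`PendantB.Gc_pendant_b`: `Q = avoidAll ends5 2 {1}`, `bL = Q ∩ {a₁ ↔ b}`, …). -/
theorem y_eq_bern (p : Fin 10 → R) :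
    prob p (avoidAll ends5 2 {1} ∩ connEvent ends5 2 4) *
          (prob p (avoidAll ends5 2 {1} ∩ connEvent ends5 1 0) -
            prob p (avoidAll ends5 2 {1} ∩ (connEvent ends5 1 0 ∩ connEvent ends5 1 4)) -
            prob p (avoidAll ends5 2 {1} ∩ (connEvent ends5 1 0 ∩ connEvent ends5 2 4))) -
        (prob p (avoidAll ends5 2 {1}) - prob p (avoidAll ends5 2 {1} ∩ connEvent ends5 1 4) -
            prob p (avoidAll ends5 2 {1} ∩ connEvent ends5 2 4)) *
          prob p (avoidAll ends5 2 {1} ∩ (connEvent ends5 1 0 ∩ connEvent ends5 2 4)) +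
      (prob p (avoidAll ends5 2 {1} ∩ connEvent ends5 1 4) *
          (prob p (avoidAll ends5 2 {1} ∩ connEvent ends5 2 0) -
            prob p (avoidAll ends5 2 {1} ∩ (connEvent ends5 2 0 ∩ connEvent ends5 2 4)) -
            prob p (avoidAll ends5 2 {1} ∩ (connEvent ends5 2 0 ∩ connEvent ends5 1 4))) -
        (prob p (avoidAll ends5 2 {1}) - prob p (avoidAll ends5 2 {1} ∩ connEvent ends5 1 4) -
            prob p (avoidAll ends5 2 {1} ∩ connEvent ends5 2 4)) *
          prob p (avoidAll ends5 2 {1} ∩ (connEvent ends5 2 0 ∩ connEvent ends5 1 4))) =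
      ∑ k, bern p k * ((cntPosY k : ℕ) - (cntNegY k : ℕ) : R) := by
  rw [prob_eq_bform p _ _ tQB_iff, prob_eq_bform p _ _ Pendant.tQLo_iff', prob_eq_bform p _ _ tQLoBL_iff,
    prob_eq_bform p _ _ Pendant.tQBLo_iff', prob_eq_bform p _ _ tQ_iff, prob_eq_bform p _ _ tQBL_iff,
    prob_eq_bform p _ _ Pendant.tQHo_iff', prob_eq_bform p _ _ tQHoBH_iff,
    prob_eq_bform p _ _ Pendant.tQBLHo_iff']
  have e : ∀ bH oL A Dd P bL oH B C one : R, one = 1 →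
      bH * (oL - A - Dd) - (P - bL - bH) * Dd + (bL * (oH - B - C) - (P - bL - bH) * C) =
        bH * oL * one + bL * Dd * one + bL * oH * one + bH * C * one -
          bH * A * one - P * Dd * one - bL * B * one - P * C * one := by
    intros; subst_vars; ring
  rw [e _ _ _ _ _ _ _ _ _ (bform p (indR tOne)) (one_eq_bform p).symm, bform_mul_mul, bform_mul_mul,
    bform_mul_mul, bform_mul_mul, bform_mul_mul, bform_mul_mul, bform_mul_mul, bform_mul_mul,
    ← Finset.sum_add_distrib, ← Finset.sum_add_distrib, ← Finset.sum_add_distrib, ← Finset.sum_sub_distrib,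
    ← Finset.sum_sub_distrib, ← Finset.sum_sub_distrib, ← Finset.sum_sub_distrib]
  refine Finset.sum_congr rfl fun k _ => ?_
  rw [coef3_eq_cnt3, coef3_eq_cnt3, coef3_eq_cnt3, coef3_eq_cnt3, coef3_eq_cnt3, coef3_eq_cnt3,
    coef3_eq_cnt3, coef3_eq_cnt3]
  unfold cntPosY cntNegY
  push_cast
  ring

end Bernstein

end PM

end K5

end Summit.Ventures.PercRepro2
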